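import Mathlib
import Literature.MathematicalPhysics.QuantumFieldTheory.BalabanImbrieJaffe1984to88.BIJ85LandauForm441

/-!
# `BalabanImbrieJaffe1984to88.BIJ85LandauMinimizer442` — T. Bałaban, J. Imbrie, A. Jaffe, *Renormalization of the Higgs
model: minimizers, propagators and the stability of mean field theory*, Commun. Math. Phys. **97** (1985) 299–329
[BalabanImbrieJaffe1985]: **(4.4.1)–(4.4.3)** pp. 311–312 — the Landau-gauge Faddeev–Popov function `𝒢(∂*A)`, `Z_k(B)` and the
Landau gauge minimizer `H_kB` TYPED AS PRINTED (Gaussian integrals over the subspace `N(Q′)` and over the fibres `{Q_kA = B}`),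
and the sentence of p. 313 *"H_kB is the configuration which minimizes the action ½‖∂A‖², subject to a gauge condition as well
as the restriction Q_kA = B"* PROVED (file 2/2; file 1/2 = `BIJ85LandauForm441`: the operators, the form `E = ½‖∂A‖² + ½‖R∂*A‖²`,
the gauge condition)

statement-level skeleton of published theorems with citation tags; proofs where landed; nothing here is a claim about the Yang–Mills mass gap

PDF held: `paper:balaban1985-cmp97-bij-higgs-minimizers` (journal page = PDF page + 298); renders of pp. 311–312 [PDF 13–14] read as
images (`run/shared/lean/pub/lit-balaban/lit-balaban-r15/pages/…-p013-x2.png`, `…-p014-x2.png`); [6I] = [Balaban1984PropagatorsI]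
pp. 25–26, 29–30 [PDF 9–10, 13–14].

CITATION HEADER (lean-in-tree rule).  Phase-2 proof seat p11 of `lit-balaban` (HOME `run/shared/lean/pub/lit-balaban/`), SPARE row
**C1.Eq4.4.1-4.4.3** (`PHASE2-TARGETS.md` §G.6 footer: *"type as printed + prove the provable member"*).  The printed text is quoted
in file 1/2.  HOW THE δ-FUNCTIONS ARE READ (as [6I] reads them, (1.40) p. 25: *"∫dλ δ(Q′_kλ) exp(−(1/2α)‖Δλ‖²) = ∫_{N(Q′_k)} dλ
exp(…)"*): `∫dλ δ(Q′λ)(…)` = the integral over the subspace `N(Q′)` for the Lebesgue measure of its inner product (`fpDen`), and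
`∫𝒟A δ(Q_kA − B)(…)` = the integral over the affine fibre `{Q_kA = B} = A₀ + N(Q_k)` for the Lebesgue measure of `N(Q_k)`
(`fibInt`, independent of the base point `A₀`: `fibInt_eq_of_mem`).  The Jacobian constants `|det(Q′Q′*)|^{−1/2}`,
`|det(Q_kQ_k*)|^{−1/2}` of the δ-function normalization are NOT carried (they multiply `𝒢` and `Z_k(B)` by A- and B-independent
constants and cancel in the quotient (4.4.2)); this is the only deviation from the print.

WHAT IS PROVED (every hypothesis displayed; the two non-degeneracy inputs are the printed claims «no zero modes» (`hZ`: a field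
with Q_kA = 0, ∂A = 0, R∂*A = 0 vanishes — the Landau-gauge form of p. 309, [6I] p. 30) and «Δ is positive definite on N(Q′_k)»
(`hL`, [6I] p. 25)):
* `calG_eq` — **𝒢 is Gaussian**: `𝒢(u) = c_R⁻¹·exp(−½‖Ru‖²)`, `R` the orthogonal projection onto `ΔN(Q′)`, `c_R = ∫_{N(Q′)}
  e^{−½‖Δλ‖²}dλ` (completing the square over `N(Q′)` + translation invariance: `fpDen_eq`) — this is [6I] (1.40)–(1.41) at α = 1,
  whose α → 0 limit is the δ-function Landau gauge `δ_R(∂*A)` of [6I] (1.47); hence `𝒢(∂*A)e^{−½‖∂A‖²} = c_R⁻¹e^{−E(A)}` with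
  `E = ½‖∂A‖² + ½‖R∂*A‖²` (`weight_eq`), and `0 < c_R` (`cR_pos`);
* `Hk_eq_of_isMinOn` — **THE GAUSSIAN MEAN IS THE MINIMIZER**: if `A₀` minimizes `E` on the fibre then `H_kB = A₀` and `Z_k(B) > 0`
  ([6I] p. 29 «We make the translation A = A′ + H_kB»: the weight splits `e^{−E(A₀)}e^{−E(v)}`, `E(−v) = E(v)`, and the odd
  integral `∫_{N(Q_k)} e^{−E(v)} v dv` vanishes);
* `Hk_spec` — `Q_kH_kB = B` (cf. (4.1.5)), `H_kB` is the UNIQUE minimizer of `E` on the fibre, `Z_k(B) > 0`;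
* `Hk_isLandauMinimizer` — **p. 313 / [6I] p. 26 AS PRINTED**: given the abelian gauge structure of file 1/2 (∂∂λ = 0, ∂*∂λ = Δλ,
  Q_k∂λ = 0 for λ ∈ N(Q′)), `Q_kH_kB = B`, `R∂*H_kB = 0` (the Landau gauge condition of [6I]) and `½‖∂H_kB‖² ≤ ½‖∂A‖²` for every
  `A` with `Q_kA = B`, `R∂*A = 0`; `eq_Hk_of_isMinOn_curl` — conversely every minimizer of `½‖∂A‖²` on `{Q_kA = B, R∂*A = 0}` IS
  `H_kB`, i.e. (4.4.2) is [6I]'s operator `H_k` of (1.47)/(1.63) (*"its value on such a configuration is equal to a configuration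
  A on T_η minimizing the form ½⟨∂A, ∂A⟩ under the conditions Q_kA = B, R∂*A = 0"*, [6I] p. 26).
Carrier clauses (F6): as in file 1/2 — the theorems hold for every instance of the five operators on finite-dimensional real
inner-product spaces.  Private lemmas = Mathlib-level Gaussian facts.  Axioms: the standard three.  Unit `lit-balaban-p11`.
-/

namespace Literature.MathematicalPhysics.QuantumFieldTheory.BalabanImbrieJaffe1984to88.BIJ85LandauMinimizer442

open MeasureTheory
open scoped InnerProductSpace
open Literature.MathematicalPhysics.QuantumFieldTheory.BalabanImbrieJaffe1984to88.BIJ85LandauForm441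

noncomputable section

/-! ## Private Gaussian lemmas on a finite-dimensional real inner-product space with its Lebesgue measure -/
section Gaussian

variable {V : Type*} [NormedAddCommGroup V] [InnerProductSpace ℝ V] [FiniteDimensional ℝ V]
  [MeasurableSpace V] [BorelSpace V]

/-- `v ↦ e^{−b‖v‖²}` is integrable, `b > 0`. [folklore] -/
private theorem integrable_exp_neg_mul_sq_norm {b : ℝ} (hb : 0 < b) :
    Integrable (fun v : V => Real.exp (-b * ‖v‖ ^ 2)) := by
  apply Integrable.of_integral_ne_zero
  rw [GaussianFourier.integral_rexp_neg_mul_sq_norm hb]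
  positivity

/-- `v ↦ ‖v‖e^{−b‖v‖²}` is integrable, `b > 0`. [folklore] -/
private theorem integrable_norm_mul_exp_neg_mul_sq_norm {b : ℝ} (hb : 0 < b) :
    Integrable (fun v : V => ‖v‖ * Real.exp (-b * ‖v‖ ^ 2)) := by
  have hb2 : 0 < b / 2 := half_pos hb
  refine ((integrable_exp_neg_mul_sq_norm (V := V) hb2).const_mul (1 + 2 / b)).mono' ?_ ?_
  · exact (continuous_norm.mul (by fun_prop)).aestronglyMeasurable
  · refine Filter.Eventually.of_forall fun v => ?_
    have hx : 0 ≤ ‖v‖ := norm_nonneg v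
    have h1 : ‖v‖ ≤ (1 + 2 / b) * (1 + b / 2 * ‖v‖ ^ 2) := by
      have : (1 + 2 / b) * (1 + b / 2 * ‖v‖ ^ 2) = 1 + ‖v‖ ^ 2 + 2 / b + b / 2 * ‖v‖ ^ 2 := by
        field_simp
        ring
      rw [this]
      nlinarith [sq_nonneg (‖v‖ - 1), div_pos two_pos hb, mul_nonneg hb2.le (sq_nonneg ‖v‖)]
    have h2 : 1 + b / 2 * ‖v‖ ^ 2 ≤ Real.exp (b / 2 * ‖v‖ ^ 2) := by
      have := Real.add_one_le_exp (b / 2 * ‖v‖ ^ 2)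
      linarith
    have h3 : ‖v‖ ≤ (1 + 2 / b) * Real.exp (b / 2 * ‖v‖ ^ 2) :=
      h1.trans (mul_le_mul_of_nonneg_left h2 (by positivity))
    rw [Real.norm_eq_abs, abs_of_nonneg (mul_nonneg hx (Real.exp_pos _).le)]
    have hsplit : Real.exp (-b * ‖v‖ ^ 2) = Real.exp (-(b / 2) * ‖v‖ ^ 2) * Real.exp (-(b / 2 * ‖v‖ ^ 2)) := by
      rw [← Real.exp_add]
      congr 1
      ring
    have hkey : ‖v‖ * Real.exp (-(b / 2 * ‖v‖ ^ 2)) ≤ 1 + 2 / b := by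
      rw [Real.exp_neg]
      calc ‖v‖ * (Real.exp (b / 2 * ‖v‖ ^ 2))⁻¹
          ≤ (1 + 2 / b) * Real.exp (b / 2 * ‖v‖ ^ 2) * (Real.exp (b / 2 * ‖v‖ ^ 2))⁻¹ :=
            mul_le_mul_of_nonneg_right h3 (by positivity)
        _ = 1 + 2 / b := by field_simp
    rw [hsplit]
    calc ‖v‖ * (Real.exp (-(b / 2) * ‖v‖ ^ 2) * Real.exp (-(b / 2 * ‖v‖ ^ 2)))
        = (‖v‖ * Real.exp (-(b / 2 * ‖v‖ ^ 2))) * Real.exp (-(b / 2) * ‖v‖ ^ 2) := by ring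
      _ ≤ (1 + 2 / b) * Real.exp (-(b / 2) * ‖v‖ ^ 2) :=
            mul_le_mul_of_nonneg_right hkey (Real.exp_pos _).le

variable {F : Type*} [NormedAddCommGroup F] [NormedSpace ℝ F]

omit [MeasurableSpace V] [BorelSpace V] in
/-- an injective linear map on a finite-dimensional space is bounded below. [folklore] -/
private theorem exists_mul_norm_sq_le (T : V →ₗ[ℝ] F) (hT : LinearMap.ker T = ⊥) :
    ∃ m : ℝ, 0 < m ∧ ∀ v, m * ‖v‖ ^ 2 ≤ ‖T v‖ ^ 2 := by
  obtain ⟨K, hK, hA⟩ := T.exists_antilipschitzWith hT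
  refine ⟨((K : ℝ) ^ 2)⁻¹, by positivity, fun v => ?_⟩
  have h := hA.le_mul_dist v 0
  simp only [dist_zero_right, map_zero] at h
  rw [inv_mul_le_iff₀ (by positivity)]
  calc ‖v‖ ^ 2 ≤ ((K : ℝ) * ‖T v‖) ^ 2 := by gcongr
    _ = (K : ℝ) ^ 2 * ‖T v‖ ^ 2 := by ring

/-- Gaussian domination. [folklore] -/
private theorem integrable_exp_neg_of_le {q : V → ℝ} (hq : Continuous q) {m : ℝ} (hm : 0 < m)
    (hle : ∀ v, m * ‖v‖ ^ 2 ≤ q v) : Integrable (fun v : V => Real.exp (-q v)) := by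
  refine (integrable_exp_neg_mul_sq_norm (V := V) hm).mono' (by fun_prop) ?_
  refine Filter.Eventually.of_forall fun v => ?_
  rw [Real.norm_eq_abs, abs_of_nonneg (Real.exp_pos _).le, Real.exp_le_exp]
  linarith [hle v]

/-- Gaussian domination, first moment. [folklore] -/
private theorem integrable_norm_mul_exp_neg_of_le {q : V → ℝ} (hq : Continuous q) {m : ℝ} (hm : 0 < m)
    (hle : ∀ v, m * ‖v‖ ^ 2 ≤ q v) : Integrable (fun v : V => ‖v‖ * Real.exp (-q v)) := by
  refine (integrable_norm_mul_exp_neg_mul_sq_norm (V := V) hm).mono' ?_ ?_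
  · exact (continuous_norm.mul (by fun_prop)).aestronglyMeasurable
  · refine Filter.Eventually.of_forall fun v => ?_
    rw [Real.norm_eq_abs, abs_of_nonneg (mul_nonneg (norm_nonneg v) (Real.exp_pos _).le)]
    refine mul_le_mul_of_nonneg_left ?_ (norm_nonneg v)
    rw [Real.exp_le_exp]
    linarith [hle v]

/-- positivity of a Gaussian-dominated integral. [folklore] -/
private theorem integral_exp_neg_pos {q : V → ℝ} (hq : Continuous q) {m : ℝ} (hm : 0 < m)
    (hle : ∀ v, m * ‖v‖ ^ 2 ≤ q v) : 0 < ∫ v : V, Real.exp (-q v) := by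
  rw [integral_pos_iff_support_of_nonneg (fun v => (Real.exp_pos _).le) (integrable_exp_neg_of_le hq hm hle)]
  have hsupp : Function.support (fun v : V => Real.exp (-q v)) = Set.univ :=
    Set.eq_univ_of_forall fun v => Function.mem_support.mpr (Real.exp_pos _).ne'
  rw [hsupp]
  exact isOpen_univ.measure_pos volume Set.univ_nonempty

/-- the integral of an odd function vanishes (the Lebesgue measure is even). [folklore] -/
private theorem integral_eq_zero_of_odd {f : V → F} (hf : ∀ v, f (-v) = -f v) : ∫ v, f v = 0 := by
  have h := integral_neg_eq_self f (volume : Measure V)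
  simp only [hf, integral_neg] at h
  have : (2 : ℝ) • ∫ v, f v = 0 := by rw [two_smul]; nth_rewrite 1 [← h]; simp
  simpa using this

end Gaussian

/-! ## (4.4.1): the Faddeev–Popov function, Gaussian in `R∂*A` -/

section FP

variable {EA ES EP EB ES' : Type*}
  [NormedAddCommGroup EA] [InnerProductSpace ℝ EA]
  [NormedAddCommGroup ES] [InnerProductSpace ℝ ES] [FiniteDimensional ℝ ES] [MeasurableSpace ES] [BorelSpace ES]
  [NormedAddCommGroup EP] [InnerProductSpace ℝ EP]
  [AddCommGroup EB] [Module ℝ EB] [AddCommGroup ES'] [Module ℝ ES']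
  (D : LandauOps EA ES EP EB ES')

/-- the DENOMINATOR of **(4.4.1)**, `∫dλ δ(Q′λ) exp(−½‖∂*A − Δλ‖²)` = the integral over the subspace `N(Q′)` for its Lebesgue measure
([6I] (1.40)), as a function of `u = ∂*A`. [cite: BalabanImbrieJaffe1985, (4.4.1) p.311] -/
def fpDen (u : ES) : ℝ := ∫ l : D.kerQp, Real.exp (-(1 / 2 : ℝ) * ‖u - D.lap (l : ES)‖ ^ 2)

/-- **(4.4.1)** p. 311 [PDF 13], verbatim: *"𝒢(∂*A) = exp(−½‖∂*A‖²)/(∫dλ δ(Q′λ) exp(−½‖∂*A − Δλ‖²)), (4.4.1) where Q′ denotes the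
ordinary average over k-blocks"*, as a function of `u = ∂*A`. [cite: BalabanImbrieJaffe1985, (4.4.1) p.311] -/
def calG (u : ES) : ℝ := Real.exp (-(1 / 2 : ℝ) * ‖u‖ ^ 2) / fpDen D u

/-- the constant `c_R = ∫_{N(Q′)} exp(−½‖Δλ‖²) dλ` (`= fpDen 0`). [cite: BalabanImbrieJaffe1985, (4.4.1) p.311] -/
def cR : ℝ := ∫ l : D.kerQp, Real.exp (-(1 / 2 : ℝ) * ‖D.lap (l : ES)‖ ^ 2)

/-- completing the square over `N(Q′)`: `∫_{N(Q′)} e^{−½‖u − Δλ‖²}dλ = e^{−½‖u − Ru‖²}·c_R` (orthogonality `u − Ru ⊥ ΔN(Q′)`,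
translation invariance of dλ). [cite: Balaban1984PropagatorsI, (1.40) p.25] -/
theorem fpDen_eq (u : ES) : fpDen D u = Real.exp (-(1 / 2 : ℝ) * ‖u - D.projR u‖ ^ 2) * cR D := by
  obtain ⟨l0, hl0, hl0eq⟩ : ∃ l0 ∈ D.kerQp, D.lap l0 = D.projR u :=
    Submodule.mem_map.mp (D.gaugeRange.starProjection_apply_mem u)
  set L0 : D.kerQp := ⟨l0, hl0⟩ with hL0
  have hpt : ∀ l : D.kerQp, ‖u - D.lap (l : ES)‖ ^ 2
      = ‖u - D.projR u‖ ^ 2 + ‖D.lap ((l - L0 : D.kerQp) : ES)‖ ^ 2 := by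
    intro l
    have hdecomp : u - D.lap (l : ES) = (u - D.projR u) + D.lap ((L0 - l : D.kerQp) : ES) := by
      simp only [Submodule.coe_sub, map_sub, hL0, hl0eq]
      abel
    have horth : ⟪u - D.projR u, D.lap ((L0 - l : D.kerQp) : ES)⟫_ℝ = 0 := by
      apply Submodule.starProjection_inner_eq_zero
      exact Submodule.mem_map_of_mem (L0 - l).2
    rw [hdecomp, norm_add_sq_real, horth, mul_zero, add_zero]
    congr 1
    rw [← norm_neg, ← map_neg, ← Submodule.coe_neg, neg_sub]
  unfold fpDen
  simp_rw [hpt, mul_add, Real.exp_add]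
  rw [integral_const_mul]
  congr 1
  exact integral_sub_right_eq_self (fun l : D.kerQp => Real.exp (-(1 / 2 : ℝ) * ‖D.lap (l : ES)‖ ^ 2)) L0

/-- **𝒢 is Gaussian in `R∂*A`**: `𝒢(u) = c_R⁻¹·exp(−½‖Ru‖²)` — [6I] (1.40)–(1.41) p. 25 at α = 1 (there: *"𝒢_α(∂*A) →_{α→0}
|det(Δ↾_{N(Q′_k)})|δ_R(∂*A), (1.41) where δ_R is a δ-function concentrated at the origin of the sub-space R"*).
[cite: Balaban1984PropagatorsI, (1.41) p.25] -/
theorem calG_eq (u : ES) : calG D u = (cR D)⁻¹ * Real.exp (-(1 / 2 : ℝ) * ‖D.projR u‖ ^ 2) := by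
  unfold calG
  rw [fpDen_eq]
  have hsq : ‖u‖ ^ 2 = ‖D.projR u‖ ^ 2 + ‖u - D.projR u‖ ^ 2 := by
    rw [Submodule.norm_sq_eq_add_norm_sq_starProjection u D.gaugeRange, LandauOps.projR,
      Submodule.starProjection_orthogonal_val]
  rw [hsq, mul_add, Real.exp_add, mul_comm (Real.exp (-(1 / 2 : ℝ) * ‖u - D.projR u‖ ^ 2)) (cR D),
    mul_div_mul_right _ _ (Real.exp_pos _).ne', div_eq_inv_mul]

/-- `0 < c_R` under [6I]'s «Δ is positive definite on N(Q′_k)» (hypothesis `hL`): the λ-integral of (4.4.1) converges and `𝒢` is a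
genuine positive function. [cite: Balaban1984PropagatorsI, p.25 (text)] -/
theorem cR_pos (hL : ∀ l : ES, D.Qp l = 0 → D.lap l = 0 → l = 0) : 0 < cR D := by
  let T : D.kerQp →ₗ[ℝ] ES := D.lap.comp D.kerQp.subtype
  have hT : LinearMap.ker T = ⊥ := by
    rw [LinearMap.ker_eq_bot']
    intro l hl
    exact Subtype.ext (hL (l : ES) ((D.mem_kerQp).mp l.2) hl)
  obtain ⟨m, hm, hle⟩ := exists_mul_norm_sq_le T hT
  have hcont : Continuous fun l : D.kerQp => (1 / 2 : ℝ) * ‖D.lap (l : ES)‖ ^ 2 := by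
    have h1 : Continuous D.lap := D.lap.continuous_of_finiteDimensional
    fun_prop
  have hpos := integral_exp_neg_pos hcont (half_pos hm) (fun l => by
    have := hle l
    show m / 2 * ‖l‖ ^ 2 ≤ (1 / 2 : ℝ) * ‖D.lap (l : ES)‖ ^ 2
    change m * ‖l‖ ^ 2 ≤ ‖D.lap (l : ES)‖ ^ 2 at this
    linarith)
  unfold cR
  simp_rw [neg_mul]
  exact hpos

/-- the integrand weight of (4.4.2)–(4.4.3): `𝒢(∂*A)exp(−½‖∂A‖²)`. [cite: BalabanImbrieJaffe1985, (4.4.3) p.312] -/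
def weight (A : EA) : ℝ := calG D (D.dstar A) * Real.exp (-(1 / 2 : ℝ) * ‖D.curl A‖ ^ 2)

/-- after the λ-integration the weight is the Gaussian of the Landau-gauge form: `𝒢(∂*A)e^{−½‖∂A‖²} = c_R⁻¹e^{−E(A)}`,
`E = ½‖∂A‖² + ½‖R∂*A‖²`. [cite: BalabanImbrieJaffe1985, (4.4.1)–(4.4.3) p.311–312] -/
theorem weight_eq (A : EA) : weight D A = (cR D)⁻¹ * Real.exp (-D.energy A) := by
  rw [weight, calG_eq, LandauOps.energy, mul_assoc, ← Real.exp_add]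
  congr 2
  ring

end FP

/-! ## (4.4.2)–(4.4.3): the fibre integrals; the mean is the minimizer -/

section FibreIntegral

variable {EA ES EP EB ES' : Type*}
  [NormedAddCommGroup EA] [InnerProductSpace ℝ EA] [FiniteDimensional ℝ EA] [MeasurableSpace EA] [BorelSpace EA]
  [NormedAddCommGroup ES] [InnerProductSpace ℝ ES]
  [NormedAddCommGroup EP] [InnerProductSpace ℝ EP]
  [AddCommGroup EB] [Module ℝ EB] [AddCommGroup ES'] [Module ℝ ES']
  (D : LandauOps EA ES EP EB ES')

open scoped Classical in
/-- the constrained integral `∫𝒟A δ(Q_kA − B) F(A)` of (4.4.2)–(4.4.3): the integral of `F` over the affine fibre `{Q_kA = B}` for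
its Lebesgue measure, `∫_{N(Q_k)} F(A₀ + v) dv` with `A₀` any point of the fibre (independence: `fibInt_eq_of_mem`); `0` on an empty
fibre. [cite: BalabanImbrieJaffe1985, (4.4.3) p.312] -/
def fibInt {X : Type*} [NormedAddCommGroup X] [NormedSpace ℝ X] (F : EA → X) (B : EB) : X :=
  if h : ∃ A, D.Qk A = B then ∫ v : D.kerQk, F (h.choose + (v : EA)) else 0

/-- base-point independence: for ANY `A₀` with `Q_kA₀ = B`, `∫𝒟A δ(Q_kA − B) F(A) = ∫_{N(Q_k)} F(A₀ + v) dv` (translation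
invariance of the Lebesgue measure of `N(Q_k)`; [6I] p. 29 «We make the translation A = A′ + H_kB»).
[cite: Balaban1984PropagatorsI, (1.64) p.29] -/
theorem fibInt_eq_of_mem {X : Type*} [NormedAddCommGroup X] [NormedSpace ℝ X] (F : EA → X) {B : EB} {A₀ : EA}
    (hA₀ : D.Qk A₀ = B) : fibInt D F B = ∫ v : D.kerQk, F (A₀ + (v : EA)) := by
  have hex : ∃ A, D.Qk A = B := ⟨A₀, hA₀⟩
  unfold fibInt
  rw [dif_pos hex]
  have hA₁ : D.Qk hex.choose = B := hex.choose_spec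
  have hu : hex.choose - A₀ ∈ D.kerQk := by rw [LandauOps.mem_kerQk, map_sub, hA₁, hA₀, sub_self]
  set u : D.kerQk := ⟨hex.choose - A₀, hu⟩ with hu'
  have hpt : ∀ v : D.kerQk, hex.choose + (v : EA) = A₀ + ((u + v : D.kerQk) : EA) := by
    intro v
    simp only [hu', Submodule.coe_add]
    abel
  simp_rw [hpt]
  exact integral_add_left_eq_self (μ := volume) (fun v : D.kerQk => F (A₀ + (v : EA))) u

end FibreIntegral

section Mean

variable {EA ES EP EB ES' : Type*}
  [NormedAddCommGroup EA] [InnerProductSpace ℝ EA] [FiniteDimensional ℝ EA] [MeasurableSpace EA] [BorelSpace EA]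
  [NormedAddCommGroup ES] [InnerProductSpace ℝ ES] [FiniteDimensional ℝ ES] [MeasurableSpace ES] [BorelSpace ES]
  [NormedAddCommGroup EP] [InnerProductSpace ℝ EP]
  [AddCommGroup EB] [Module ℝ EB] [AddCommGroup ES'] [Module ℝ ES']
  (D : LandauOps EA ES EP EB ES')

/-- **(4.4.3)** p. 312 [PDF 14], verbatim: *"Z_k(B) = ∫𝒟A δ(Q_kA − B)𝒢(∂*A) exp(−½‖∂A‖²). (4.4.3)"*
[cite: BalabanImbrieJaffe1985, (4.4.3) p.312] -/
def Zk (B : EB) : ℝ := fibInt D (weight D) B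

/-- **(4.4.2)** p. 312 [PDF 14], verbatim: *"Such a Faddeev-Popov type choice leads to the formula for the Landau gauge minimizer
H_kB = Z_k(B)⁻¹∫𝒟A δ(Q_kA − B)𝒢(∂*A) A exp(−½‖∂A‖²), (4.4.2)"*. [cite: BalabanImbrieJaffe1985, (4.4.2) p.312] -/
def Hk (B : EB) : EA := (Zk D B)⁻¹ • fibInt D (fun A => weight D A • A) B

/-- **the Gaussian mean is the minimizer**: if `A₀` minimizes `E = ½‖∂A‖² + ½‖R∂*A‖²` on the fibre `{Q_kA = B}`, then `H_kB = A₀`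
and `Z_k(B) > 0` ([6I] p. 29: after «the translation A = A′ + H_kB» the weight is `c_R⁻¹e^{−E(A₀)}e^{−E(v)}`, even in `v ∈ N(Q_k)`,
so `∫ e^{−E(v)} v dv = 0`). [cite: BalabanImbrieJaffe1985, (4.4.2) p.312] -/
theorem Hk_eq_of_isMinOn (hZ : ∀ v : EA, D.Qk v = 0 → D.curl v = 0 → D.projR (D.dstar v) = 0 → v = 0)
    (hL : ∀ l : ES, D.Qp l = 0 → D.lap l = 0 → l = 0) {B : EB} {A₀ : EA} (hA₀ : D.Qk A₀ = B)
    (hmin : IsMinOn D.energy (D.Fibre B) A₀) : Hk D B = A₀ ∧ 0 < Zk D B := by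
  obtain ⟨m, hm, hle⟩ := D.energy_lower hZ
  set c : ℝ := (cR D)⁻¹ * Real.exp (-D.energy A₀) with hc
  have hc_pos : 0 < c := mul_pos (inv_pos.mpr (cR_pos D hL)) (Real.exp_pos _)
  have hcont : Continuous fun v : D.kerQk => D.energy (v : EA) := D.continuous_energy.comp continuous_subtype_val
  have hw : ∀ v : D.kerQk, weight D (A₀ + (v : EA)) = c * Real.exp (-D.energy (v : EA)) := by
    intro v
    rw [weight_eq, D.energy_split_of_isMinOn hA₀ hmin ((D.mem_kerQk).mp v.2), neg_add, Real.exp_add, hc, mul_assoc]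
  have hZk : Zk D B = c * ∫ v : D.kerQk, Real.exp (-D.energy (v : EA)) := by
    rw [Zk, fibInt_eq_of_mem D _ hA₀]
    simp_rw [hw]
    exact integral_const_mul _ _
  have hI_pos : 0 < ∫ v : D.kerQk, Real.exp (-D.energy (v : EA)) := integral_exp_neg_pos hcont hm hle
  have hZpos : 0 < Zk D B := by rw [hZk]; exact mul_pos hc_pos hI_pos
  have hint1 : Integrable (fun v : D.kerQk => (c * Real.exp (-D.energy (v : EA))) • A₀) :=
    ((integrable_exp_neg_of_le hcont hm hle).const_mul c).smul_const A₀
  have hint2 : Integrable (fun v : D.kerQk => (c * Real.exp (-D.energy (v : EA))) • (v : EA)) := by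
    refine ((integrable_norm_mul_exp_neg_of_le hcont hm hle).const_mul c).mono' ?_ ?_
    · exact ((continuous_const.mul (by fun_prop)).smul continuous_subtype_val).aestronglyMeasurable
    · refine Filter.Eventually.of_forall fun v => ?_
      rw [norm_smul, Real.norm_eq_abs, abs_of_pos (mul_pos hc_pos (Real.exp_pos _)), Submodule.coe_norm]
      exact le_of_eq (by ring)
  have hodd : ∫ v : D.kerQk, (c * Real.exp (-D.energy (v : EA))) • (v : EA) = 0 := by
    apply integral_eq_zero_of_odd
    intro v
    rw [Submodule.coe_neg, LandauOps.energy_neg, smul_neg]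
  have hnum : fibInt D (fun A => weight D A • A) B = (Zk D B) • A₀ := by
    rw [fibInt_eq_of_mem D _ hA₀]
    calc ∫ v : D.kerQk, weight D (A₀ + (v : EA)) • (A₀ + (v : EA))
        = ∫ v : D.kerQk, ((c * Real.exp (-D.energy (v : EA))) • A₀
            + (c * Real.exp (-D.energy (v : EA))) • (v : EA)) := by
          congr 1
          funext v
          rw [hw, smul_add]
      _ = (∫ v : D.kerQk, (c * Real.exp (-D.energy (v : EA))) • A₀)
            + ∫ v : D.kerQk, (c * Real.exp (-D.energy (v : EA))) • (v : EA) := integral_add hint1 hint2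
      _ = (Zk D B) • A₀ := by rw [integral_smul_const, hodd, add_zero, integral_const_mul, hZk]
  refine ⟨?_, hZpos⟩
  rw [Hk, hnum, inv_smul_smul₀ hZpos.ne']

/-- **`H_kB` is the (unique) constrained minimizer**: for a non-empty fibre, `Q_kH_kB = B` (cf. (4.1.5) *"Note that by definition
Q_kH_{k,Ax}B = B"*), `H_kB` minimizes `E` on `{Q_kA = B}`, `Z_k(B) > 0`, and every minimizer equals `H_kB`.
[cite: BalabanImbrieJaffe1985, (4.4.2) p.312] -/
theorem Hk_spec (hZ : ∀ v : EA, D.Qk v = 0 → D.curl v = 0 → D.projR (D.dstar v) = 0 → v = 0)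
    (hL : ∀ l : ES, D.Qp l = 0 → D.lap l = 0 → l = 0) {B : EB} (hB : ∃ A, D.Qk A = B) :
    D.Qk (Hk D B) = B ∧ IsMinOn D.energy (D.Fibre B) (Hk D B) ∧ 0 < Zk D B ∧
      ∀ A₀, D.Qk A₀ = B → IsMinOn D.energy (D.Fibre B) A₀ → A₀ = Hk D B := by
  obtain ⟨A₁, hA₁⟩ := hB
  obtain ⟨A₀, hA₀, hmin⟩ := D.exists_isMinOn hZ hA₁
  obtain ⟨h, hZk⟩ := Hk_eq_of_isMinOn D hZ hL hA₀ hmin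
  exact ⟨h ▸ hA₀, h ▸ hmin, hZk, fun A hA hminA => (Hk_eq_of_isMinOn D hZ hL hA hminA).1.symm⟩

/-- **p. 313, AS PRINTED** (verbatim: *"Recall that H_kB is the configuration which minimizes the action ½‖∂A‖², subject to a gauge
condition as well as the restriction Q_kA = B on field averages"*; [6I] p. 26: *"a configuration A on T_η minimizing the form
½⟨∂A, ∂A⟩ under the conditions Q_kA = B, R∂*A = 0"*): given the abelian gauge structure `∂∂λ = 0`, `∂*∂λ = Δλ`, `Q_k∂λ = 0`
(λ ∈ N(Q′)), the field `H_kB` of (4.4.2) satisfies `Q_kH_kB = B`, the Landau gauge condition `R∂*H_kB = 0`, and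
`½‖∂H_kB‖² ≤ ½‖∂A‖²` for every `A` with `Q_kA = B`, `R∂*A = 0`. [cite: BalabanImbrieJaffe1985, p.313 (text)] -/
theorem Hk_isLandauMinimizer (hZ : ∀ v : EA, D.Qk v = 0 → D.curl v = 0 → D.projR (D.dstar v) = 0 → v = 0)
    (hL : ∀ l : ES, D.Qp l = 0 → D.lap l = 0 → l = 0) {grad : ES →ₗ[ℝ] EA}
    (hg : D.GaugeStructure grad) {B : EB} (hB : ∃ A, D.Qk A = B) :
    D.Qk (Hk D B) = B ∧ D.projR (D.dstar (Hk D B)) = 0 ∧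
      ∀ A : EA, D.Qk A = B → D.projR (D.dstar A) = 0 →
        (1 / 2 : ℝ) * ‖D.curl (Hk D B)‖ ^ 2 ≤ (1 / 2 : ℝ) * ‖D.curl A‖ ^ 2 := by
  obtain ⟨hQ, hmin, -, -⟩ := Hk_spec D hZ hL hB
  refine ⟨hQ, D.projR_dstar_eq_zero_of_isMinOn hg hQ hmin, fun A hA hAP => ?_⟩
  exact (isMinOn_iff.mp (D.isMinOn_curl_of_isMinOn hg hQ hmin)) A ⟨hA, hAP⟩

/-- **uniqueness on the Landau-gauge fibre — (4.4.2) IS the operator `H_k` of [6I] (1.47)/(1.63)**: any minimizer of `½‖∂A‖²`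
over `{Q_kA = B, R∂*A = 0}` equals `H_kB` ([6I] p. 26: *"its value on such a configuration is equal to a configuration A on T_η
minimizing the form ½⟨∂A, ∂A⟩ under the conditions Q_kA = B, R∂*A = 0"*; uniqueness = [6I] p. 30 positivity, here `hZ`).
[cite: Balaban1984PropagatorsI, (1.47) p.26] -/
theorem eq_Hk_of_isMinOn_curl (hZ : ∀ v : EA, D.Qk v = 0 → D.curl v = 0 → D.projR (D.dstar v) = 0 → v = 0)
    (hL : ∀ l : ES, D.Qp l = 0 → D.lap l = 0 → l = 0) {grad : ES →ₗ[ℝ] EA}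
    (hg : D.GaugeStructure grad) {B : EB} {A₁ : EA} (hA₁ : D.Qk A₁ = B) (hA₁R : D.projR (D.dstar A₁) = 0)
    (hmin : IsMinOn (fun A => (1 / 2 : ℝ) * ‖D.curl A‖ ^ 2) {A | D.Qk A = B ∧ D.projR (D.dstar A) = 0} A₁) :
    A₁ = Hk D B := by
  obtain ⟨hQ, hminE, -, huniq⟩ := Hk_spec D hZ hL ⟨A₁, hA₁⟩
  have hR := D.projR_dstar_eq_zero_of_isMinOn hg hQ hminE
  refine huniq A₁ hA₁ ?_
  rw [isMinOn_iff]
  intro A hA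
  have h1 : (1 / 2 : ℝ) * ‖D.curl A₁‖ ^ 2 ≤ (1 / 2 : ℝ) * ‖D.curl (Hk D B)‖ ^ 2 :=
    (isMinOn_iff.mp hmin) (Hk D B) ⟨hQ, hR⟩
  have h2 : D.energy (Hk D B) ≤ D.energy A := (isMinOn_iff.mp hminE) A hA
  have e1 : D.energy A₁ = (1 / 2 : ℝ) * ‖D.curl A₁‖ ^ 2 := by simp [LandauOps.energy, hA₁R]
  have e2 : D.energy (Hk D B) = (1 / 2 : ℝ) * ‖D.curl (Hk D B)‖ ^ 2 := by simp [LandauOps.energy, hR]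
  linarith

end Mean

end

end Literature.MathematicalPhysics.QuantumFieldTheory.BalabanImbrieJaffe1984to88.BIJ85LandauMinimizer442
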